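import Literature.Computability.AlgebraicComplexity.QuantumFunctionalsProofs
import Literature.Computability.AlgebraicComplexity.QuantumFunctionalsDegenerationProofs
import Literature.Computability.AlgebraicComplexity.PermutationCommutant
import Literature.Computability.AlgebraicComplexity.SubspaceProjection
import HarnessLib

/-!
# Tensor powers of a 3-tensor: action, quantum marginals, and a three-projection union bound

Topic: `Literature/Computability/AlgebraicComplexity`; bookkeeping for the elementary proof of
CVZ Thm. 3.34 (`ChristandlVranaZuiddam2023_le_upperSupportFunctional`, `QuantumFunctionals.lean`).
The tensor power `t^{⊗n} = kroneckerPow t n` (`AsymptoticSpectrum.lean`) lives on the word index types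
`Fin n → ι`, `Fin n → κ`, `Fin n → μ`; this file relates it to the Kronecker powers of matrices
`powMat` (`PermutationCommutant.lean`) and to the quantum marginals of `QuantumFunctionals.lean`:

* `kroneckerPow_actTensor_powMat` — `((A ⊗ B ⊗ C)·t)^{⊗n} = (A^{⊗n} ⊗ B^{⊗n} ⊗ C^{⊗n})·t^{⊗n}`;
* `reducedDensity₁/₂/₃_kroneckerPow` — `|t^{⊗n}⟩⟨t^{⊗n}|ⱼ = (|t⟩⟨t|ⱼ)^{⊗n}`; `tensorNormSq_kroneckerPow`
  (`‖t^{⊗n}‖² = ‖t‖^{2n}`), `kroneckerPow_ne_zero`;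
* actions on one leg: `actTensor_leg₁/₂/₃_apply` (`(P ⊗ 1 ⊗ 1)·X` acts column-wise by `P *ᵥ`), and the
  expectation values `⟨X, (P ⊗ 1 ⊗ 1) X⟩ = tr(P |X⟩⟨X|₁)` etc. (`inner_actTensor_leg₁/₂/₃`),
  `inner_self_eq_tensorNormSq`;
* `re_inner_le_sum_three_proj` — **union bound for three commuting projections**: if Hermitian
  idempotent, pairwise commuting `P₁, P₂, P₃` fix the three summands of `y = y₁ + y₂ + y₃`
  respectively, then `‖y‖² ≤ ∑ⱼ re ⟨y, Pⱼ y⟩` (the projection onto `N₁ + N₂ + N₃` is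
  `1 - ∏ (1 - Pⱼ) ≤ ∑ Pⱼ`); and its instance `tensorNormSq_le_sum_three_legs` for projections acting
  on the three legs of a 3-tensor (which commute automatically).

No definitions are introduced; all statements are folklore.
-/

noncomputable section

open scoped BigOperators Matrix ComplexOrder Kronecker

namespace Literature.Computability.AlgebraicComplexity

/-! ## Products of sums over words -/

section ProdSum

variable {R : Type*} [CommSemiring R] {κ μ ι : Type*} [Fintype κ] [Fintype μ] [Fintype ι] {n : ℕ}

/-- `∏ₘ ∑_b ∑_c F m b c = ∑_{v,w} ∏ₘ F m (v m) (w m)` (distributivity, twice). [folklore] -/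
theorem prod_sum_sum_eq (F : Fin n → κ → μ → R) :
    ∏ m, ∑ b, ∑ c, F m b c = ∑ v : Fin n → κ, ∑ w : Fin n → μ, ∏ m, F m (v m) (w m) := by
  rw [Fintype.prod_sum]
  exact Finset.sum_congr rfl fun v _ => Fintype.prod_sum _

/-- `∏ₘ ∑_a ∑_b ∑_c F m a b c = ∑_{u,v,w} ∏ₘ F m (u m) (v m) (w m)`. [folklore] -/
theorem prod_sum_sum_sum_eq (F : Fin n → ι → κ → μ → R) :
    ∏ m, ∑ a, ∑ b, ∑ c, F m a b c =
      ∑ u : Fin n → ι, ∑ v : Fin n → κ, ∑ w : Fin n → μ, ∏ m, F m (u m) (v m) (w m) := by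
  rw [Fintype.prod_sum]
  exact Finset.sum_congr rfl fun u _ => prod_sum_sum_eq _

end ProdSum

/-! ## Tensor powers: the action and the marginals -/

section Powers

variable {ι κ μ ι' κ' μ' : Type*}

/-- **The action commutes with tensor powers**:
`((A ⊗ B ⊗ C)·t)^{⊗n} = (A^{⊗n} ⊗ B^{⊗n} ⊗ C^{⊗n})·t^{⊗n}`. [folklore] -/
theorem kroneckerPow_actTensor_powMat [Fintype ι] [Fintype κ] [Fintype μ] (A : Matrix ι' ι ℂ)
    (B : Matrix κ' κ ℂ) (C : Matrix μ' μ ℂ) (t : ι → κ → μ → ℂ) (n : ℕ) :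
    kroneckerPow (actTensor A B C t) n =
      actTensor (powMat A n) (powMat B n) (powMat C n) (kroneckerPow t n) := by
  funext u v w
  simp only [kroneckerPow_apply, actTensor_apply, powMat_apply]
  rw [prod_sum_sum_sum_eq fun m a b c => A (u m) a * B (v m) b * C (w m) c * t a b c]
  refine Finset.sum_congr rfl fun u' _ => Finset.sum_congr rfl fun v' _ =>
    Finset.sum_congr rfl fun w' _ => ?_
  simp only [Finset.prod_mul_distrib]

/-- **First marginal of a tensor power**: `|x^{⊗n}⟩⟨x^{⊗n}|₁ = (|x⟩⟨x|₁)^{⊗n}`. [folklore] -/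
theorem reducedDensity₁_kroneckerPow [Fintype κ'] [Fintype μ'] (x : ι' → κ' → μ' → ℂ) (n : ℕ) :
    reducedDensity₁ (kroneckerPow x n) = powMat (reducedDensity₁ x) n := by
  ext u u'
  simp only [reducedDensity₁_apply, kroneckerPow_apply, powMat_apply, star_prod,
    ← Finset.prod_mul_distrib]
  exact (prod_sum_sum_eq fun m b c => x (u m) b c * star (x (u' m) b c)).symm

/-- **Second marginal of a tensor power**: `|x^{⊗n}⟩⟨x^{⊗n}|₂ = (|x⟩⟨x|₂)^{⊗n}`. [folklore] -/
theorem reducedDensity₂_kroneckerPow [Fintype ι'] [Fintype μ'] (x : ι' → κ' → μ' → ℂ) (n : ℕ) :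
    reducedDensity₂ (kroneckerPow x n) = powMat (reducedDensity₂ x) n := by
  ext v v'
  simp only [reducedDensity₂_apply, kroneckerPow_apply, powMat_apply, star_prod,
    ← Finset.prod_mul_distrib]
  exact (prod_sum_sum_eq fun m a c => x a (v m) c * star (x a (v' m) c)).symm

/-- **Third marginal of a tensor power**: `|x^{⊗n}⟩⟨x^{⊗n}|₃ = (|x⟩⟨x|₃)^{⊗n}`. [folklore] -/
theorem reducedDensity₃_kroneckerPow [Fintype ι'] [Fintype κ'] (x : ι' → κ' → μ' → ℂ) (n : ℕ) :
    reducedDensity₃ (kroneckerPow x n) = powMat (reducedDensity₃ x) n := by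
  ext w w'
  simp only [reducedDensity₃_apply, kroneckerPow_apply, powMat_apply, star_prod,
    ← Finset.prod_mul_distrib]
  exact (prod_sum_sum_eq fun m a b => x a b (w m) * star (x a b (w' m))).symm

/-- `‖x^{⊗n}‖² = (‖x‖²)^n`. [folklore] -/
theorem tensorNormSq_kroneckerPow [Fintype ι'] [Fintype κ'] [Fintype μ'] (x : ι' → κ' → μ' → ℂ)
    (n : ℕ) :
    tensorNormSq (kroneckerPow x n) = tensorNormSq x ^ n := by
  have h := trace_reducedDensity₁ (kroneckerPow x n)
  rw [reducedDensity₁_kroneckerPow, trace_powMat, trace_reducedDensity₁] at h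
  exact_mod_cast h.symm

/-- A tensor power of a nonzero tensor is nonzero. [folklore] -/
theorem kroneckerPow_ne_zero [Fintype ι'] [Fintype κ'] [Fintype μ'] {x : ι' → κ' → μ' → ℂ}
    (hx : x ≠ 0) (n : ℕ) : kroneckerPow x n ≠ 0 := by
  intro h
  have h1 : tensorNormSq (kroneckerPow x n) = 0 := (tensorNormSq_eq_zero_iff _).2 h
  rw [tensorNormSq_kroneckerPow] at h1
  exact pow_ne_zero n (tensorNormSq_pos hx).ne' h1

/-- A nonzero entry of `t^{⊗n}` has all its letters in the support of `t`. [folklore] -/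
theorem apply_ne_zero_of_kroneckerPow_ne_zero {t : ι' → κ' → μ' → ℂ} {n : ℕ} {u : Fin n → ι'}
    {v : Fin n → κ'} {w : Fin n → μ'} (h : kroneckerPow t n u v w ≠ 0) (m : Fin n) :
    t (u m) (v m) (w m) ≠ 0 := by
  rw [kroneckerPow_apply] at h
  exact Finset.prod_ne_zero_iff.1 h m (Finset.mem_univ m)

end Powers

/-! ## Acting on one leg; expectation values -/

section Legs

variable {α β γ : Type*} [Fintype α] [Fintype β] [Fintype γ] [DecidableEq α] [DecidableEq β]
  [DecidableEq γ]

omit [DecidableEq α] in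
/-- `((P ⊗ 1 ⊗ 1)·X)_{abc} = (P (X_{·bc}))_a`. [folklore] -/
theorem actTensor_leg₁_apply (P : Matrix α α ℂ) (X : α → β → γ → ℂ) (a : α) (b : β) (c : γ) :
    actTensor P (1 : Matrix β β ℂ) (1 : Matrix γ γ ℂ) X a b c = (P *ᵥ fun a' => X a' b c) a := by
  rw [actTensor_apply]
  simp only [Matrix.mulVec, dotProduct]
  refine Finset.sum_congr rfl fun a' _ => ?_
  rw [Finset.sum_eq_single b, Finset.sum_eq_single c]
  · simp
  · intro c' _ hc'; simp [Ne.symm hc']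
  · intro h; exact absurd (Finset.mem_univ c) h
  · intro b' _ hb'; simp [Matrix.one_apply, Ne.symm hb']
  · intro h; exact absurd (Finset.mem_univ b) h

omit [DecidableEq β] in
/-- `((1 ⊗ P ⊗ 1)·X)_{abc} = (P (X_{a·c}))_b`. [folklore] -/
theorem actTensor_leg₂_apply (P : Matrix β β ℂ) (X : α → β → γ → ℂ) (a : α) (b : β) (c : γ) :
    actTensor (1 : Matrix α α ℂ) P (1 : Matrix γ γ ℂ) X a b c = (P *ᵥ fun b' => X a b' c) b := by
  rw [actTensor_apply, Finset.sum_eq_single a]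
  · simp only [Matrix.mulVec, dotProduct]
    refine Finset.sum_congr rfl fun b' _ => ?_
    rw [Finset.sum_eq_single c]
    · simp
    · intro c' _ hc'; simp [Ne.symm hc']
    · intro h; exact absurd (Finset.mem_univ c) h
  · intro a' _ ha'; simp [Matrix.one_apply, Ne.symm ha']
  · intro h; exact absurd (Finset.mem_univ a) h

omit [DecidableEq γ] in
/-- `((1 ⊗ 1 ⊗ P)·X)_{abc} = (P (X_{ab·}))_c`. [folklore] -/
theorem actTensor_leg₃_apply (P : Matrix γ γ ℂ) (X : α → β → γ → ℂ) (a : α) (b : β) (c : γ) :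
    actTensor (1 : Matrix α α ℂ) (1 : Matrix β β ℂ) P X a b c = (P *ᵥ fun c' => X a b c') c := by
  rw [actTensor_apply, Finset.sum_eq_single a]
  · rw [Finset.sum_eq_single b]
    · simp [Matrix.mulVec, dotProduct]
    · intro b' _ hb'; simp [Ne.symm hb']
    · intro h; exact absurd (Finset.mem_univ b) h
  · intro a' _ ha'; simp [Matrix.one_apply, Ne.symm ha']
  · intro h; exact absurd (Finset.mem_univ a) h

omit [DecidableEq α] [DecidableEq β] [DecidableEq γ] in
/-- `⟨X, X⟩ = ‖X‖²` for the coordinate Hermitian form. [folklore] -/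
theorem inner_self_eq_tensorNormSq (X : α → β → γ → ℂ) :
    ∑ a, ∑ b, ∑ c, star (X a b c) * X a b c = (tensorNormSq X : ℂ) := by
  simp only [tensorNormSq, Complex.ofReal_sum]
  refine Finset.sum_congr rfl fun a _ => Finset.sum_congr rfl fun b _ =>
    Finset.sum_congr rfl fun c _ => ?_
  rw [Complex.star_def, Complex.conj_mul', Complex.ofReal_pow]

omit [DecidableEq α] in
/-- `⟨X, (P ⊗ 1 ⊗ 1) X⟩ = tr(P |X⟩⟨X|₁)`. [folklore] -/
theorem inner_actTensor_leg₁ (P : Matrix α α ℂ) (X : α → β → γ → ℂ) :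
    ∑ a, ∑ b, ∑ c, star (X a b c) * actTensor P (1 : Matrix β β ℂ) (1 : Matrix γ γ ℂ) X a b c =
      (P * reducedDensity₁ X).trace := by
  simp only [actTensor_leg₁_apply, Matrix.mulVec, dotProduct, Matrix.trace, Matrix.diag,
    Matrix.mul_apply, reducedDensity₁_apply, Finset.mul_sum]
  -- left: `∑ a b c a'`, right: `∑ a a' b c`
  refine Finset.sum_congr rfl fun a _ => ?_
  calc ∑ b, ∑ c, ∑ a', star (X a b c) * (P a a' * X a' b c)
      = ∑ b, ∑ a', ∑ c, star (X a b c) * (P a a' * X a' b c) :=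
        Finset.sum_congr rfl fun b _ => Finset.sum_comm
    _ = ∑ a', ∑ b, ∑ c, star (X a b c) * (P a a' * X a' b c) := Finset.sum_comm
    _ = ∑ a', ∑ b, ∑ c, P a a' * (X a' b c * star (X a b c)) :=
        Finset.sum_congr rfl fun a' _ => Finset.sum_congr rfl fun b _ =>
          Finset.sum_congr rfl fun c _ => by ring

omit [DecidableEq β] in
/-- `⟨X, (1 ⊗ P ⊗ 1) X⟩ = tr(P |X⟩⟨X|₂)`. [folklore] -/
theorem inner_actTensor_leg₂ (P : Matrix β β ℂ) (X : α → β → γ → ℂ) :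
    ∑ a, ∑ b, ∑ c, star (X a b c) * actTensor (1 : Matrix α α ℂ) P (1 : Matrix γ γ ℂ) X a b c =
      (P * reducedDensity₂ X).trace := by
  simp only [actTensor_leg₂_apply, Matrix.mulVec, dotProduct, Matrix.trace, Matrix.diag,
    Matrix.mul_apply, reducedDensity₂_apply, Finset.mul_sum]
  -- left: `∑ a b c b'`, right: `∑ b b' a c`
  rw [Finset.sum_comm]
  refine Finset.sum_congr rfl fun b _ => ?_
  calc ∑ a, ∑ c, ∑ b', star (X a b c) * (P b b' * X a b' c)
      = ∑ a, ∑ b', ∑ c, star (X a b c) * (P b b' * X a b' c) :=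
        Finset.sum_congr rfl fun a _ => Finset.sum_comm
    _ = ∑ b', ∑ a, ∑ c, star (X a b c) * (P b b' * X a b' c) := Finset.sum_comm
    _ = ∑ b', ∑ a, ∑ c, P b b' * (X a b' c * star (X a b c)) :=
        Finset.sum_congr rfl fun b' _ => Finset.sum_congr rfl fun a _ =>
          Finset.sum_congr rfl fun c _ => by ring

omit [DecidableEq γ] in
/-- `⟨X, (1 ⊗ 1 ⊗ P) X⟩ = tr(P |X⟩⟨X|₃)`. [folklore] -/
theorem inner_actTensor_leg₃ (P : Matrix γ γ ℂ) (X : α → β → γ → ℂ) :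
    ∑ a, ∑ b, ∑ c, star (X a b c) * actTensor (1 : Matrix α α ℂ) (1 : Matrix β β ℂ) P X a b c =
      (P * reducedDensity₃ X).trace := by
  simp only [actTensor_leg₃_apply, Matrix.mulVec, dotProduct, Matrix.trace, Matrix.diag,
    Matrix.mul_apply, reducedDensity₃_apply, Finset.mul_sum]
  -- left: `∑ a b c c'`, right: `∑ c c' a b`
  calc ∑ a, ∑ b, ∑ c, ∑ c', star (X a b c) * (P c c' * X a b c')
      = ∑ a, ∑ c, ∑ b, ∑ c', star (X a b c) * (P c c' * X a b c') :=
        Finset.sum_congr rfl fun a _ => Finset.sum_comm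
    _ = ∑ c, ∑ a, ∑ b, ∑ c', star (X a b c) * (P c c' * X a b c') := Finset.sum_comm
    _ = ∑ c, ∑ c', ∑ a, ∑ b, P c c' * (X a b c' * star (X a b c)) := by
        refine Finset.sum_congr rfl fun c _ => ?_
        calc ∑ a, ∑ b, ∑ c', star (X a b c) * (P c c' * X a b c')
            = ∑ a, ∑ c', ∑ b, star (X a b c) * (P c c' * X a b c') :=
              Finset.sum_congr rfl fun a _ => Finset.sum_comm
          _ = ∑ c', ∑ a, ∑ b, star (X a b c) * (P c c' * X a b c') := Finset.sum_comm
          _ = ∑ c', ∑ a, ∑ b, P c c' * (X a b c' * star (X a b c)) :=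
              Finset.sum_congr rfl fun c' _ => Finset.sum_congr rfl fun a _ =>
                Finset.sum_congr rfl fun b _ => by ring

end Legs

/-! ## A union bound for three commuting projections -/

section UnionBound

variable {Y : Type*} [Fintype Y] [DecidableEq Y]

omit [DecidableEq Y] in
/-- For Hermitian `P` and any `z`, `⟨y, P z⟩ = ⟨P y, z⟩`. [folklore] -/
theorem star_dotProduct_mulVec_of_isHermitian {P : Matrix Y Y ℂ} (hP : P.IsHermitian) (y z : Y → ℂ) :
    star y ⬝ᵥ P *ᵥ z = star (P *ᵥ y) ⬝ᵥ z := by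
  rw [Matrix.dotProduct_mulVec, Matrix.star_mulVec, hP.eq]

/-- **Union bound for three commuting orthogonal projections.** Let `P₁, P₂, P₃` be Hermitian
idempotent and pairwise commuting, and let `y = y₁ + y₂ + y₃` with `Pⱼ yⱼ = yⱼ`. Then
`re ⟨y, y⟩ ≤ ∑ⱼ re ⟨y, Pⱼ y⟩`. (Write `y = P₁y + Q₁P₂y + Q₁Q₂P₃y` with `Qⱼ = 1 - Pⱼ`, since
`Q₁Q₂Q₃ y = 0`, and bound the last two terms by `⟨y, P₂ y⟩`, `⟨y, P₃ y⟩`.) [folklore] -/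
theorem re_inner_le_sum_three_proj {P₁ P₂ P₃ : Matrix Y Y ℂ} (h₁ : P₁.IsHermitian)
    (h₂ : P₂.IsHermitian) (h₃ : P₃.IsHermitian) (e₁ : P₁ * P₁ = P₁) (e₂ : P₂ * P₂ = P₂)
    (e₃ : P₃ * P₃ = P₃) (c₁₂ : P₁ * P₂ = P₂ * P₁) (c₁₃ : P₁ * P₃ = P₃ * P₁)
    (c₂₃ : P₂ * P₃ = P₃ * P₂) {y y₁ y₂ y₃ : Y → ℂ} (hy : y = y₁ + y₂ + y₃)
    (f₁ : P₁ *ᵥ y₁ = y₁) (f₂ : P₂ *ᵥ y₂ = y₂) (f₃ : P₃ *ᵥ y₃ = y₃) :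
    (star y ⬝ᵥ y).re ≤
      (star y ⬝ᵥ P₁ *ᵥ y).re + (star y ⬝ᵥ P₂ *ᵥ y).re + (star y ⬝ᵥ P₃ *ᵥ y).re := by
  -- the complementary projections
  set Q₁ := (1 : Matrix Y Y ℂ) - P₁ with hQ₁
  set Q₂ := (1 : Matrix Y Y ℂ) - P₂ with hQ₂
  set Q₃ := (1 : Matrix Y Y ℂ) - P₃ with hQ₃
  obtain ⟨hQ₁h, hQ₁e⟩ := one_sub_proj h₁ e₁
  obtain ⟨hQ₂h, hQ₂e⟩ := one_sub_proj h₂ e₂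
  have hq₁ : Q₁ *ᵥ y₁ = 0 := by rw [hQ₁, Matrix.sub_mulVec, Matrix.one_mulVec, f₁, sub_self]
  have hq₂ : Q₂ *ᵥ y₂ = 0 := by rw [hQ₂, Matrix.sub_mulVec, Matrix.one_mulVec, f₂, sub_self]
  have hq₃ : Q₃ *ᵥ y₃ = 0 := by rw [hQ₃, Matrix.sub_mulVec, Matrix.one_mulVec, f₃, sub_self]
  -- commutation of the `Q`'s with each other and with the `P`'s
  have cQ₁₂ : Q₁ * Q₂ = Q₂ * Q₁ := by
    rw [hQ₁, hQ₂]; simp only [Matrix.sub_mul, Matrix.mul_sub, Matrix.one_mul, Matrix.mul_one, c₁₂]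
    abel
  have cQ₁₃ : Q₁ * Q₃ = Q₃ * Q₁ := by
    rw [hQ₁, hQ₃]; simp only [Matrix.sub_mul, Matrix.mul_sub, Matrix.one_mul, Matrix.mul_one, c₁₃]
    abel
  have cQ₂₃ : Q₂ * Q₃ = Q₃ * Q₂ := by
    rw [hQ₂, hQ₃]; simp only [Matrix.sub_mul, Matrix.mul_sub, Matrix.one_mul, Matrix.mul_one, c₂₃]
    abel
  have cQ₁P₂ : Q₁ * P₂ = P₂ * Q₁ := by
    rw [hQ₁]; simp only [Matrix.sub_mul, Matrix.mul_sub, Matrix.one_mul, Matrix.mul_one, c₁₂]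
  have cQ₁P₃ : Q₁ * P₃ = P₃ * Q₁ := by
    rw [hQ₁]; simp only [Matrix.sub_mul, Matrix.mul_sub, Matrix.one_mul, Matrix.mul_one, c₁₃]
  have cQ₂P₃ : Q₂ * P₃ = P₃ * Q₂ := by
    rw [hQ₂]; simp only [Matrix.sub_mul, Matrix.mul_sub, Matrix.one_mul, Matrix.mul_one, c₂₃]
  -- `Q₁ Q₂ Q₃ y = 0`
  have hkill : (Q₁ * Q₂ * Q₃) *ᵥ y = 0 := by
    rw [hy, Matrix.mulVec_add, Matrix.mulVec_add]
    have r1 : Q₁ * Q₂ * Q₃ = Q₂ * Q₃ * Q₁ := by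
      rw [cQ₁₂, Matrix.mul_assoc, cQ₁₃, ← Matrix.mul_assoc]
    have t1 : (Q₁ * Q₂ * Q₃) *ᵥ y₁ = 0 := by
      rw [r1, ← Matrix.mulVec_mulVec, hq₁, Matrix.mulVec_zero]
    have t2 : (Q₁ * Q₂ * Q₃) *ᵥ y₂ = 0 := by
      rw [show Q₁ * Q₂ * Q₃ = Q₁ * Q₃ * Q₂ by rw [Matrix.mul_assoc, cQ₂₃, ← Matrix.mul_assoc],
        ← Matrix.mulVec_mulVec, hq₂, Matrix.mulVec_zero]
    have t3 : (Q₁ * Q₂ * Q₃) *ᵥ y₃ = 0 := by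
      rw [← Matrix.mulVec_mulVec, hq₃, Matrix.mulVec_zero]
    rw [t1, t2, t3, add_zero, add_zero]
  -- the telescoping decomposition `y = P₁ y + Q₁ P₂ y + Q₁ Q₂ P₃ y`
  have hdec : y = P₁ *ᵥ y + (Q₁ * P₂) *ᵥ y + (Q₁ * Q₂ * P₃) *ᵥ y := by
    have h : P₁ + Q₁ * P₂ + Q₁ * Q₂ * P₃ + Q₁ * Q₂ * Q₃ = 1 := by
      rw [hQ₁, hQ₂, hQ₃]
      noncomm_ring
    have := congrArg (fun M : Matrix Y Y ℂ => M *ᵥ y) h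
    simp only [Matrix.add_mulVec, Matrix.one_mulVec, hkill, add_zero] at this
    exact this.symm
  -- second term: `⟨y, Q₁P₂ y⟩ = ⟨P₂ y, Q₁ (P₂ y)⟩ ≤ ⟨P₂ y, P₂ y⟩ = ⟨y, P₂ y⟩`
  have hT2 : (star y ⬝ᵥ (Q₁ * P₂) *ᵥ y).re ≤ (star y ⬝ᵥ P₂ *ᵥ y).re := by
    have key : P₂ * Q₁ * P₂ = Q₁ * P₂ := by
      rw [Matrix.mul_assoc, cQ₁P₂, ← Matrix.mul_assoc, e₂]
    have hrw : (Q₁ * P₂) *ᵥ y = P₂ *ᵥ (Q₁ *ᵥ (P₂ *ᵥ y)) := by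
      rw [Matrix.mulVec_mulVec, Matrix.mulVec_mulVec, key]
    rw [hrw, star_dotProduct_mulVec_of_isHermitian h₂, star_dotProduct_mulVec_eq_of_proj h₂ e₂]
    exact re_dotProduct_mulVec_le hQ₁h hQ₁e _
  -- third term: `Q₁Q₂` is a Hermitian idempotent commuting with `P₃`
  have hQQh : (Q₁ * Q₂).IsHermitian := by
    have : (Q₁ * Q₂)ᴴ = Q₁ * Q₂ := by rw [Matrix.conjTranspose_mul, hQ₁h.eq, hQ₂h.eq, cQ₁₂]
    exact this
  have hQQe : Q₁ * Q₂ * (Q₁ * Q₂) = Q₁ * Q₂ := by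
    rw [Matrix.mul_assoc, ← Matrix.mul_assoc Q₂ Q₁, ← cQ₁₂, Matrix.mul_assoc, hQ₂e, ← Matrix.mul_assoc,
      hQ₁e]
  have hT3 : (star y ⬝ᵥ (Q₁ * Q₂ * P₃) *ᵥ y).re ≤ (star y ⬝ᵥ P₃ *ᵥ y).re := by
    have cRP : Q₁ * Q₂ * P₃ = P₃ * (Q₁ * Q₂) := by
      rw [Matrix.mul_assoc, cQ₂P₃, ← Matrix.mul_assoc, cQ₁P₃, Matrix.mul_assoc]
    have key : P₃ * (Q₁ * Q₂) * P₃ = Q₁ * Q₂ * P₃ := by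
      rw [Matrix.mul_assoc, cRP, ← Matrix.mul_assoc, e₃]
    have hrw : (Q₁ * Q₂ * P₃) *ᵥ y = P₃ *ᵥ ((Q₁ * Q₂) *ᵥ (P₃ *ᵥ y)) := by
      rw [Matrix.mulVec_mulVec, Matrix.mulVec_mulVec, key]
    rw [hrw, star_dotProduct_mulVec_of_isHermitian h₃, star_dotProduct_mulVec_eq_of_proj h₃ e₃]
    exact re_dotProduct_mulVec_le hQQh hQQe _
  -- assemble
  have hsum : star y ⬝ᵥ y =
      star y ⬝ᵥ P₁ *ᵥ y + star y ⬝ᵥ (Q₁ * P₂) *ᵥ y + star y ⬝ᵥ (Q₁ * Q₂ * P₃) *ᵥ y := by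
    rw [← dotProduct_add, ← dotProduct_add, ← hdec]
  rw [hsum, Complex.add_re, Complex.add_re]
  linarith

end UnionBound

/-! ## The union bound for projections on the three legs of a 3-tensor -/

section ThreeLegs

variable {α β γ : Type*} [Fintype α] [Fintype β] [Fintype γ] [DecidableEq α] [DecidableEq β]
  [DecidableEq γ]

omit [DecidableEq α] [DecidableEq β] [DecidableEq γ] in
/-- Reading a 3-tensor as a vector on the product index type turns the action into the Kronecker
product matrix (function form of `actTensor_eq_kronecker_mulVec`). [folklore] -/
theorem vec_actTensor (A : Matrix α α ℂ) (B : Matrix β β ℂ) (C : Matrix γ γ ℂ) (X : α → β → γ → ℂ) :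
    (fun p : α × β × γ => actTensor A B C X p.1 p.2.1 p.2.2) =
      (A ⊗ₖ (B ⊗ₖ C)) *ᵥ fun p : α × β × γ => X p.1 p.2.1 p.2.2 := by
  funext p
  exact actTensor_eq_kronecker_mulVec A B C X p.1 p.2.1 p.2.2

omit [DecidableEq α] [DecidableEq β] [DecidableEq γ] in
/-- The coordinate Hermitian form of tensors read as vectors. [folklore] -/
theorem star_vec_dotProduct_vec (X Z : α → β → γ → ℂ) :
    star (fun p : α × β × γ => X p.1 p.2.1 p.2.2) ⬝ᵥ (fun p : α × β × γ => Z p.1 p.2.1 p.2.2) =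
      ∑ a, ∑ b, ∑ c, star (X a b c) * Z a b c := by
  simp only [dotProduct, Pi.star_apply, Fintype.sum_prod_type]

omit [Fintype α] [Fintype β] [Fintype γ] [DecidableEq α] [DecidableEq β] [DecidableEq γ] in
/-- A Kronecker product `A ⊗ (B ⊗ C)` of Hermitian matrices is Hermitian. [folklore] -/
theorem isHermitian_kronecker₃ {A : Matrix α α ℂ} {B : Matrix β β ℂ} {C : Matrix γ γ ℂ}
    (hA : A.IsHermitian) (hB : B.IsHermitian) (hC : C.IsHermitian) : (A ⊗ₖ (B ⊗ₖ C)).IsHermitian := by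
  unfold Matrix.IsHermitian
  rw [Matrix.conjTranspose_kronecker, Matrix.conjTranspose_kronecker, hA.eq, hB.eq, hC.eq]

/-- **Union bound on the three legs.** Let `P₁, P₂, P₃` be Hermitian idempotent matrices on the three
index types of a 3-tensor `X = X₁ + X₂ + X₃`, with `(P₁ ⊗ 1 ⊗ 1) X₁ = X₁`, `(1 ⊗ P₂ ⊗ 1) X₂ = X₂`,
`(1 ⊗ 1 ⊗ P₃) X₃ = X₃`. Then `‖X‖² ≤ ∑ⱼ re tr(Pⱼ |X⟩⟨X|ⱼ)`. [folklore] -/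
theorem tensorNormSq_le_sum_three_legs {P₁ : Matrix α α ℂ} {P₂ : Matrix β β ℂ} {P₃ : Matrix γ γ ℂ}
    (h₁ : P₁.IsHermitian) (h₂ : P₂.IsHermitian) (h₃ : P₃.IsHermitian) (e₁ : P₁ * P₁ = P₁)
    (e₂ : P₂ * P₂ = P₂) (e₃ : P₃ * P₃ = P₃) {X X₁ X₂ X₃ : α → β → γ → ℂ} (hX : X = X₁ + X₂ + X₃)
    (f₁ : actTensor P₁ (1 : Matrix β β ℂ) (1 : Matrix γ γ ℂ) X₁ = X₁)
    (f₂ : actTensor (1 : Matrix α α ℂ) P₂ (1 : Matrix γ γ ℂ) X₂ = X₂)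
    (f₃ : actTensor (1 : Matrix α α ℂ) (1 : Matrix β β ℂ) P₃ X₃ = X₃) :
    tensorNormSq X ≤ (P₁ * reducedDensity₁ X).trace.re + (P₂ * reducedDensity₂ X).trace.re +
      (P₃ * reducedDensity₃ X).trace.re := by
  -- pass to vectors on `α × β × γ` and Kronecker matrices
  set vec : (α → β → γ → ℂ) → α × β × γ → ℂ := fun Z p => Z p.1 p.2.1 p.2.2 with hvec
  set K₁ : Matrix (α × β × γ) (α × β × γ) ℂ := P₁ ⊗ₖ ((1 : Matrix β β ℂ) ⊗ₖ (1 : Matrix γ γ ℂ)) with hK₁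
  set K₂ : Matrix (α × β × γ) (α × β × γ) ℂ := (1 : Matrix α α ℂ) ⊗ₖ (P₂ ⊗ₖ (1 : Matrix γ γ ℂ)) with hK₂
  set K₃ : Matrix (α × β × γ) (α × β × γ) ℂ := (1 : Matrix α α ℂ) ⊗ₖ ((1 : Matrix β β ℂ) ⊗ₖ P₃) with hK₃
  have one₁ : (1 : Matrix α α ℂ).IsHermitian := Matrix.isHermitian_one
  have one₂ : (1 : Matrix β β ℂ).IsHermitian := Matrix.isHermitian_one
  have one₃ : (1 : Matrix γ γ ℂ).IsHermitian := Matrix.isHermitian_one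
  have hK₁h : K₁.IsHermitian := isHermitian_kronecker₃ h₁ one₂ one₃
  have hK₂h : K₂.IsHermitian := isHermitian_kronecker₃ one₁ h₂ one₃
  have hK₃h : K₃.IsHermitian := isHermitian_kronecker₃ one₁ one₂ h₃
  have hK₁e : K₁ * K₁ = K₁ := by
    rw [hK₁, ← Matrix.mul_kronecker_mul, ← Matrix.mul_kronecker_mul, e₁, Matrix.mul_one, Matrix.mul_one]
  have hK₂e : K₂ * K₂ = K₂ := by
    rw [hK₂, ← Matrix.mul_kronecker_mul, ← Matrix.mul_kronecker_mul, e₂, Matrix.mul_one, Matrix.mul_one]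
  have hK₃e : K₃ * K₃ = K₃ := by
    rw [hK₃, ← Matrix.mul_kronecker_mul, ← Matrix.mul_kronecker_mul, e₃, Matrix.mul_one, Matrix.mul_one]
  have c₁₂ : K₁ * K₂ = K₂ * K₁ := by
    rw [hK₁, hK₂, ← Matrix.mul_kronecker_mul, ← Matrix.mul_kronecker_mul, ← Matrix.mul_kronecker_mul,
      ← Matrix.mul_kronecker_mul]
    simp only [Matrix.mul_one, Matrix.one_mul]
  have c₁₃ : K₁ * K₃ = K₃ * K₁ := by
    rw [hK₁, hK₃, ← Matrix.mul_kronecker_mul, ← Matrix.mul_kronecker_mul, ← Matrix.mul_kronecker_mul,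
      ← Matrix.mul_kronecker_mul]
    simp only [Matrix.mul_one, Matrix.one_mul]
  have c₂₃ : K₂ * K₃ = K₃ * K₂ := by
    rw [hK₂, hK₃, ← Matrix.mul_kronecker_mul, ← Matrix.mul_kronecker_mul, ← Matrix.mul_kronecker_mul,
      ← Matrix.mul_kronecker_mul]
    simp only [Matrix.mul_one, Matrix.one_mul]
  have hy : vec X = vec X₁ + vec X₂ + vec X₃ := by
    funext p; simp [hvec, hX]
  have g₁ : K₁ *ᵥ vec X₁ = vec X₁ := by
    rw [hK₁, hvec, ← vec_actTensor, f₁]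
  have g₂ : K₂ *ᵥ vec X₂ = vec X₂ := by
    rw [hK₂, hvec, ← vec_actTensor, f₂]
  have g₃ : K₃ *ᵥ vec X₃ = vec X₃ := by
    rw [hK₃, hvec, ← vec_actTensor, f₃]
  have hmain := re_inner_le_sum_three_proj hK₁h hK₂h hK₃h hK₁e hK₂e hK₃e c₁₂ c₁₃ c₂₃ hy g₁ g₂ g₃
  -- translate the four quadratic forms back to tensors
  have q0 : (star (vec X) ⬝ᵥ vec X).re = tensorNormSq X := by
    rw [hvec, star_vec_dotProduct_vec, inner_self_eq_tensorNormSq, Complex.ofReal_re]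
  have q1 : star (vec X) ⬝ᵥ K₁ *ᵥ vec X = (P₁ * reducedDensity₁ X).trace := by
    rw [hK₁, hvec, ← vec_actTensor, star_vec_dotProduct_vec, inner_actTensor_leg₁]
  have q2 : star (vec X) ⬝ᵥ K₂ *ᵥ vec X = (P₂ * reducedDensity₂ X).trace := by
    rw [hK₂, hvec, ← vec_actTensor, star_vec_dotProduct_vec, inner_actTensor_leg₂]
  have q3 : star (vec X) ⬝ᵥ K₃ *ᵥ vec X = (P₃ * reducedDensity₃ X).trace := by
    rw [hK₃, hvec, ← vec_actTensor, star_vec_dotProduct_vec, inner_actTensor_leg₃]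
  rw [q0, q1, q2, q3] at hmain
  exact hmain

end ThreeLegs

end Literature.Computability.AlgebraicComplexity
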